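/-
Copyright: the b2b-balaban T⁴-continuum CRUX team, row NE7b OWNER lineage `t4-ne7b-p1` (gen 142). Project licence.
-/
import Summits.QuantumFields.BalabanUV.T4Continuum.Spine.NE7b.SupWhitenedThirdKernelLetter
import Summits.QuantumFields.BalabanUV.T4Continuum.Spine.NE7b.SupWhitenedFourthCumulantRowLetter
import Summits.QuantumFields.BalabanUV.T4Continuum.Spine.NE7b.SupWhitenedSixthMoment

/-!
# PIECES FOR THE ORDER-FOUR KERNEL LETTER: reindexed triple sums, the pair∕quadruple bridges, and THE FOURTH CUMULANT'S ROW LETTER IN THE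
# TILTED FORMAT with the sixth moment discharged (SCOPING (d13)(2), tenth file).  (521) displays `∂⁴W(ψ)[e_y,e_z,e_t,e_x]` (differentiation
# direction `e_x` first in every product) as average − two-point − Hessian pairs + three-point − `κ₄`, every piece a tilted integral against
# `e^{−U(ω+ψ)}dN(0,AAᵀ)`.  The piece files bound the triple row sums `Σ_{y,z,t}` of each kind in a FIXED slot pattern ((501)∕(502)∕(512):
# `U‴xyz·U′t`, `U′x·U‴yzt`, `U″xy·U″zt`; (511): `(U″xy−b)ÂzÂt`, `Âx(U″yz−b)Ât`; (498): `κ₄(x,y,z,t)` in the WHITENED Lebesgue format); the display's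
# other placements are the same sums after a permutation of `(y,z,t)` — §1's four reindexing identities — and (498)'s whitened integrals are the
# tilted ones by the pushforward `N(0,AAᵀ) = A_*N(0,I)` — §2's bridges ((475)'s `whitened_mean_bridge`∕`whitened_triple_bridge` pattern for
# pairs and quadruples).  §3: (498)'s row letter `Σ_{y,z,t}|κ₄| ≤ C·16S³` RESTATED in the tilted format with `M₆ = 50κ₂⁶γ_op³∕(1−λγ_op)³`
# DISCHARGED by (505); §4: the fifteen-term split `|a − Σ₄b − Σ₃c + Σ₆d − e| ≤ Σ|·|` (row NE7b, node U5c; (475), (498), (505) BY NAME; [folklore])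

Cell `pub-balaban`, sub-cell `t4`, spine estimate NE7b (`T4WeightBudget.RelWeightBound`; the cell's OWN estimate — NOT PRINTED in
[Bałaban 1983–89], NOT PROVED).  Crux-route work under `Spine/NE7b/` by the row OWNER (`t4-ne7b-p1` gen 142, file (522)) under FREEZE
(0)'s crux-prover clause; NOTHING of Bałaban's is named as a Lean object, valued or asserted; no `T4Continuum/Support` leaf typed; no
`def`, no notation; zero `sorry`.  Imports (BY NAME): the OWNER's (475) `…SupWhitenedThirdKernelLetter` (`whitened_mean_bridge`; (457)
`whitened_tilted_eq_gauss`, `whitened_integral_eq` through it), (498) `…SupWhitenedFourthCumulantRowLetter` (`whitened_fourth_cumulant_row_letter`),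
(505) `…SupWhitenedSixthMoment` (`whitened_sixth_power_integrable`, `whitened_sixth_moment_gibbs`).

WHAT IS PROVED ([folklore]):
* §1 `sum3_swap12`, `sum3_swap23`, `sum3_cycle`, `sum3_cycle'` (Mathlib only); §2 `whitened_pair_bridge`, `whitened_quad_bridge`;
* §3 **`fourth_cumulant_row_letter_tilted`**; §4 `abs_fifteen_split`; §5 toy.

HONEST (what this is NOT).  Bookkeeping for the assembly (next file): NOT the order-4 kernel letter itself; the geometry letters (weights `θ, σ,
r`, the admissible `D`, `S′`) stay letters here ((499)∕(485) instantiate them).  Scalar skeleton ((A3), NC-NE7b-α UNRULED); nothing of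
Bałaban's asserted.  BY-NAME EFFECT ON THE WALL: NONE.  NE7b NOT PRINTED ∕ NOT PROVED; spine PROVED 0∕9; rung (B)+1 — the programme's measures
remain FINITE-torus statements; NOT the mass gap, NOT Clay.  HONEST DEPENDENCY: continuum YM on T⁴ ⇐ BetaPertH ∧ nine spine estimates (0∕9
proved); BetaPertH ⇐ (D1) ∧ (D4) ∧ CAP+tail; G-an2-4 gates asym, D1 and NE2∕3∕4.
-/

set_option autoImplicit false
set_option maxSynthPendingDepth 3

noncomputable section

namespace Summit.QuantumFields.BalabanUV.T4Continuum.NE7b.SupWhitenedFourthKernelPieces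

open MeasureTheory ProbabilityTheory Finset Real Matrix
open scoped BigOperators Matrix
open Literature.Probability.Distributions (matrixCLM)
open SupWhitenedCovarianceKernelLetter (whitened_tilted_eq_gauss whitened_integral_eq)
open SupWhitenedThirdKernelLetter (whitened_mean_bridge)
open SupWhitenedFourthCumulantRowLetter (whitened_fourth_cumulant_row_letter)
open SupWhitenedSixthMoment (whitened_sixth_power_integrable whitened_sixth_moment_gibbs)

variable {ι κ : Type} [Fintype ι] [DecidableEq ι] [Fintype κ] [DecidableEq κ]

/-! ## §1. Reindexing of triple sums -/

omit [DecidableEq ι] [Fintype κ] [DecidableEq κ] in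
/-- `Σ_yΣ_zΣ_t f(z,y,t) = Σ_yΣ_zΣ_t f(y,z,t)` (swap of the first two summation variables). [folklore] -/
theorem sum3_swap12 (f : ι → ι → ι → ℝ) : ∑ y, ∑ z, ∑ t, f z y t = ∑ y, ∑ z, ∑ t, f y z t := Finset.sum_comm

omit [DecidableEq ι] [Fintype κ] [DecidableEq κ] in
/-- `Σ_yΣ_zΣ_t f(y,t,z) = Σ_yΣ_zΣ_t f(y,z,t)` (swap of the last two). [folklore] -/
theorem sum3_swap23 (f : ι → ι → ι → ℝ) : ∑ y, ∑ z, ∑ t, f y t z = ∑ y, ∑ z, ∑ t, f y z t := Finset.sum_congr rfl fun _ _ => Finset.sum_comm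

omit [DecidableEq ι] [Fintype κ] [DecidableEq κ] in
/-- `Σ_yΣ_zΣ_t f(z,t,y) = Σ_yΣ_zΣ_t f(y,z,t)` (cyclic). [folklore] -/
theorem sum3_cycle (f : ι → ι → ι → ℝ) : ∑ y, ∑ z, ∑ t, f z t y = ∑ y, ∑ z, ∑ t, f y z t := by
  have h1 : ∑ y, ∑ z, ∑ t, f z t y = ∑ z, ∑ y, ∑ t, f z t y := Finset.sum_comm
  rw [h1]
  exact Finset.sum_congr rfl fun _ _ => Finset.sum_comm

omit [DecidableEq ι] [Fintype κ] [DecidableEq κ] in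
/-- `Σ_yΣ_zΣ_t f(t,y,z) = Σ_yΣ_zΣ_t f(y,z,t)` (the inverse cycle). [folklore] -/
theorem sum3_cycle' (f : ι → ι → ι → ℝ) : ∑ y, ∑ z, ∑ t, f t y z = ∑ y, ∑ z, ∑ t, f y z t := by
  have h1 : ∑ y, ∑ z, ∑ t, f t y z = ∑ y, ∑ t, ∑ z, f t y z := Finset.sum_congr rfl fun _ _ => Finset.sum_comm
  rw [h1]
  exact Finset.sum_comm

/-! ## §2. The pair and quadruple bridges from the whitened Lebesgue format to `N(0,AAᵀ)` -/

section Bridges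

variable {U : EuclideanSpace ℝ ι → ℝ} {U' : EuclideanSpace ℝ ι → EuclideanSpace ℝ ι →L[ℝ] ℝ}

/-- **The pair bridge**: for any centring constants, `E_ν(F_v−c_v)(F_w−c_w) = Z⁻¹∫e^{−U}(A_v−c_v)(A_w−c_w) dN(0,AAᵀ)`. [folklore] -/
theorem whitened_pair_bridge (hUc : Continuous U) (hU'c : Continuous U') (A : Matrix ι κ ℝ) (ψ v w : EuclideanSpace ℝ ι) (cv cw : ℝ) :
    ∫ w', (U' (matrixCLM A (WithLp.toLp 2 w') + ψ) v - cv) * (U' (matrixCLM A (WithLp.toLp 2 w') + ψ) w - cw) ∂((volume : Measure (κ → ℝ)).tilted fun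
        z => -(1 / 2 * (z ⬝ᵥ z) + U (matrixCLM A (WithLp.toLp 2 z) + ψ))) =
      (∫ ω : EuclideanSpace ℝ ι, exp (-U (ω + ψ)) ∂(multivariateGaussian 0 (A * Aᵀ)))⁻¹ * (∫ ω : EuclideanSpace ℝ ι, exp (-U (ω + ψ)) * ((U' (ω + ψ)
          v - cv) * (U' (ω + ψ) w - cw)) ∂(multivariateGaussian 0 (A * Aᵀ))) := by
  have hsh : Continuous fun ω : EuclideanSpace ℝ ι => ω + ψ := continuous_id.add continuous_const
  have he : Continuous fun ω : EuclideanSpace ℝ ι => exp (-U (ω + ψ)) := continuous_exp.comp (hUc.comp hsh).neg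
  have hg : ∀ u : EuclideanSpace ℝ ι, Continuous fun ω : EuclideanSpace ℝ ι => U' (ω + ψ) u := fun u => (hU'c.comp hsh).clm_apply continuous_const
  have hP : Continuous fun ω : EuclideanSpace ℝ ι => exp (-U (ω + ψ)) * ((U' (ω + ψ) v - cv) * (U' (ω + ψ) w - cw)) :=
    he.mul (((hg v).sub continuous_const).mul ((hg w).sub continuous_const))
  rw [whitened_tilted_eq_gauss A ψ]
  simp only [WithLp.toLp_ofLp]
  rw [whitened_integral_eq A he.aestronglyMeasurable, whitened_integral_eq A hP.aestronglyMeasurable, div_eq_inv_mul]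

/-- **The quadruple bridge**: for any centring constants,
`E_νΠ_{i=1}^4(F_{v_i}−c_i) = Z⁻¹∫e^{−U}Π_{i=1}^4(A_{v_i}−c_i) dN(0,AAᵀ)`. [folklore] -/
theorem whitened_quad_bridge (hUc : Continuous U) (hU'c : Continuous U') (A : Matrix ι κ ℝ) (ψ v₁ v₂ v₃ v₄ : EuclideanSpace ℝ ι)
    (c₁ c₂ c₃ c₄ : ℝ) :
    ∫ w', (U' (matrixCLM A (WithLp.toLp 2 w') + ψ) v₁ - c₁) * (U' (matrixCLM A (WithLp.toLp 2 w') + ψ) v₂ - c₂) * (U' (matrixCLM A (WithLp.toLp 2 w')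
        + ψ) v₃ - c₃) * (U' (matrixCLM A (WithLp.toLp 2 w') + ψ) v₄ - c₄) ∂((volume : Measure (κ → ℝ)).tilted fun z => -(1 / 2 * (z ⬝ᵥ z) + U
            (matrixCLM A (WithLp.toLp 2 z) + ψ))) =
      (∫ ω : EuclideanSpace ℝ ι, exp (-U (ω + ψ)) ∂(multivariateGaussian 0 (A * Aᵀ)))⁻¹ * (∫ ω : EuclideanSpace ℝ ι, exp (-U (ω + ψ)) * ((U' (ω + ψ)
          v₁ - c₁) * (U' (ω + ψ) v₂ - c₂) * (U' (ω + ψ) v₃ - c₃) * (U' (ω + ψ) v₄ - c₄)) ∂(multivariateGaussian 0 (A * Aᵀ))) := by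
  have hsh : Continuous fun ω : EuclideanSpace ℝ ι => ω + ψ := continuous_id.add continuous_const
  have he : Continuous fun ω : EuclideanSpace ℝ ι => exp (-U (ω + ψ)) := continuous_exp.comp (hUc.comp hsh).neg
  have hg : ∀ u : EuclideanSpace ℝ ι, Continuous fun ω : EuclideanSpace ℝ ι => U' (ω + ψ) u := fun u => (hU'c.comp hsh).clm_apply continuous_const
  have hP : Continuous fun ω : EuclideanSpace ℝ ι => exp (-U (ω + ψ)) * ((U' (ω + ψ) v₁ - c₁) * (U' (ω + ψ) v₂ - c₂) * (U' (ω + ψ) v₃ - c₃) * (U' (ω +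
      ψ) v₄ - c₄)) :=
    he.mul (((((hg v₁).sub continuous_const).mul ((hg v₂).sub continuous_const)).mul ((hg v₃).sub continuous_const)).mul ((hg v₄).sub
      continuous_const))
  rw [whitened_tilted_eq_gauss A ψ]
  simp only [WithLp.toLp_ofLp]
  rw [whitened_integral_eq A he.aestronglyMeasurable, whitened_integral_eq A hP.aestronglyMeasurable, div_eq_inv_mul]

end Bridges

/-! ## §3. The fourth cumulant's row letter in the tilted format, sixth moment discharged -/

section Kappa4

variable {U : EuclideanSpace ℝ ι → ℝ} {U' : EuclideanSpace ℝ ι → EuclideanSpace ℝ ι →L[ℝ] ℝ}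
  {U'' : EuclideanSpace ℝ ι → EuclideanSpace ℝ ι →L[ℝ] EuclideanSpace ℝ ι →L[ℝ] ℝ} {Hk : ι → ι → ℝ} {A : Matrix ι κ ℝ} {D : κ → κ → ℝ}
  {γop κ₀ κ₁ κ₂ a τ δ θp lam lamA αr αc hr γ dθ dθ' αθ βθ S' : ℝ} {θ : κ → κ → ℝ} {σ : ι → κ → ℝ} {r : ι → ι → ℝ}

/-- **THE FOURTH CUMULANT'S ROW LETTER, TILTED FORMAT** ((498) with `M₆ = 50κ₂⁶γ_op³∕(1−λγ_op)³` from (505), bridged by §2):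
`Σ_{y,z,t}|Z⁻¹∫eÂ_xÂ_yÂ_zÂ_t − Σ₃(Z⁻¹∫eÂÂ)(Z⁻¹∫eÂÂ)| ≤ C·16S′³` uniformly in the background, the site and the volume. [folklore] -/
theorem fourth_cumulant_row_letter_tilted [Nonempty κ] (hΓop : (γop • (1 : Matrix ι ι ℝ) - A * Aᵀ).PosSemidef) (Y : Finset ι)
    (hUd : ∀ φ : EuclideanSpace ℝ ι, HasFDerivAt U (U' φ) φ) (hU'd : ∀ φ : EuclideanSpace ℝ ι, HasFDerivAt U' (U'' φ) φ)
    (hU''c : Continuous U'') (hκ₀ : 0 ≤ κ₀) (hκ₁ : 0 ≤ κ₁) (ha : 0 ≤ a) (hτ : 0 < τ) (hδ : 0 < δ) (hθ0 : 0 < θp) (hθ1 : θp < 1)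
    (hκθ : (2 * κ₀ * (1 + τ) + 4 * δ) * γop ≤ θp) (hκθw : 2 * κ₀ * (1 + τ) * γop + 4 * δ ≤ θp)
    (hstab : ∀ φ : EuclideanSpace ℝ ι, -(κ₀ * ∑ x ∈ Y, φ x ^ 2) ≤ U φ)
    (hU'b : ∀ φ : EuclideanSpace ℝ ι, ‖U' φ‖ ≤ κ₁ * (a + ∑ x ∈ Y, φ x ^ 2)) (hU''b : ∀ φ : EuclideanSpace ℝ ι, ‖U'' φ‖ ≤ κ₂) (hlam : 0 ≤ lam)
    (hUsec : ∀ s : ℝ, 0 ≤ s → s ≤ 1 → ∀ a b : EuclideanSpace ℝ ι,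
      U ((1 - s) • a + s • b) - lam / 2 * (s * (1 - s)) * ∑ i, (a i - b i) ^ 2 ≤ (1 - s) * U a + s * U b)
    (hρg : lam * γop < 1)
    (hHk : ∀ (φ : EuclideanSpace ℝ ι) (x z : ι), |U'' φ (EuclideanSpace.single z (1 : ℝ)) (EuclideanSpace.single x (1 : ℝ))| ≤ Hk x z)
    (hHk0 : ∀ v u, 0 ≤ Hk v u) (ψ : EuclideanSpace ℝ ι)
    (hαr : ∀ u, ∑ w, |A u w| ≤ αr) (hαc : ∀ w, ∑ u, |A u w| ≤ αc) (hhr : ∀ v, ∑ u, Hk v u ≤ hr)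
    (hlamA : ∀ x : κ, ∑ u, ∑ v, |A u x| * |A v x| * Hk v u ≤ lamA) (hlamA1 : lamA < 1) (hγ : αc * hr * αr / (1 - lamA) ≤ γ) (hγ1 : γ < 1)
    (hD : ∀ x y, 0 ≤ D x y)
    (hDC : ∀ x y, (if x = y then (1 : ℝ) else 0) + ∑ z, D x z * ((if y = z then 0 else ∑ u, ∑ v, |A u y| * |A v z| * Hk v u) / (1 - lamA)) ≤ D x y)
    (hθnn : ∀ z w, 0 ≤ θ z w) (hDθr : ∀ z, ∑ w, D z w * θ z w ≤ dθ) (hdθ : 0 ≤ dθ) (hDθc : ∀ w, ∑ z, D z w * θ z w ≤ dθ') (hdθ' : 0 ≤ dθ')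
    (hσ0 : ∀ x w, 0 ≤ σ x w) (hσθ : ∀ x z w, σ x w ≤ σ x z * θ z w) (hr1 : ∀ x y, 1 ≤ r x y) (hrσ : ∀ x y w, r x y ^ 24 ≤ σ x w * σ y w)
    (haσ : ∀ v : ι, ∑ w, (∑ u, |A u w| * Hk v u) * σ v w ≤ αθ) (hβ : 0 ≤ βθ) (haσ' : ∀ (v : ι) (w : κ), (∑ u, |A u w| * Hk v u) * σ v w ≤ βθ)
    (hSr : ∀ u, ∑ v, (r u v ^ 2)⁻¹ ≤ S') (hSc : ∀ v, ∑ u, (r u v ^ 2)⁻¹ ≤ S') (x : ι) :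
    ∑ y, ∑ z, ∑ t, |(∫ ω : EuclideanSpace ℝ ι, exp (-U (ω + ψ)) ∂(multivariateGaussian 0 (A * Aᵀ)))⁻¹ * (∫ ω : EuclideanSpace ℝ ι, exp (-U (ω + ψ)) *
        ((U' (ω + ψ) (EuclideanSpace.single x (1 : ℝ)) - ((∫ ω : EuclideanSpace ℝ ι, exp (-U (ω + ψ)) ∂(multivariateGaussian 0 (A * Aᵀ)))⁻¹ * (∫ ω :
        EuclideanSpace ℝ ι, exp (-U (ω + ψ)) * U' (ω + ψ) (EuclideanSpace.single x (1 : ℝ)) ∂(multivariateGaussian 0 (A * Aᵀ))))) * (U' (ω + ψ)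
        (EuclideanSpace.single y (1 : ℝ)) - ((∫ ω : EuclideanSpace ℝ ι, exp (-U (ω + ψ)) ∂(multivariateGaussian 0 (A * Aᵀ)))⁻¹ * (∫ ω :
        EuclideanSpace ℝ ι, exp (-U (ω + ψ)) * U' (ω + ψ) (EuclideanSpace.single y (1 : ℝ)) ∂(multivariateGaussian 0 (A * Aᵀ))))) * (U' (ω + ψ)
        (EuclideanSpace.single z (1 : ℝ)) - ((∫ ω : EuclideanSpace ℝ ι, exp (-U (ω + ψ)) ∂(multivariateGaussian 0 (A * Aᵀ)))⁻¹ * (∫ ω :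
        EuclideanSpace ℝ ι, exp (-U (ω + ψ)) * U' (ω + ψ) (EuclideanSpace.single z (1 : ℝ)) ∂(multivariateGaussian 0 (A * Aᵀ))))) * (U' (ω + ψ)
        (EuclideanSpace.single t (1 : ℝ)) - ((∫ ω : EuclideanSpace ℝ ι, exp (-U (ω + ψ)) ∂(multivariateGaussian 0 (A * Aᵀ)))⁻¹ * (∫ ω :
        EuclideanSpace ℝ ι, exp (-U (ω + ψ)) * U' (ω + ψ) (EuclideanSpace.single t (1 : ℝ)) ∂(multivariateGaussian 0 (A * Aᵀ))))))
        ∂(multivariateGaussian 0 (A * Aᵀ))) - ((∫ ω : EuclideanSpace ℝ ι, exp (-U (ω + ψ)) ∂(multivariateGaussian 0 (A * Aᵀ)))⁻¹ * (∫ ω :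
        EuclideanSpace ℝ ι, exp (-U (ω + ψ)) * ((U' (ω + ψ) (EuclideanSpace.single x (1 : ℝ)) - ((∫ ω : EuclideanSpace ℝ ι, exp (-U (ω + ψ))
        ∂(multivariateGaussian 0 (A * Aᵀ)))⁻¹ * (∫ ω : EuclideanSpace ℝ ι, exp (-U (ω + ψ)) * U' (ω + ψ) (EuclideanSpace.single x (1 : ℝ))
        ∂(multivariateGaussian 0 (A * Aᵀ))))) * (U' (ω + ψ) (EuclideanSpace.single y (1 : ℝ)) - ((∫ ω : EuclideanSpace ℝ ι, exp (-U (ω + ψ))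
        ∂(multivariateGaussian 0 (A * Aᵀ)))⁻¹ * (∫ ω : EuclideanSpace ℝ ι, exp (-U (ω + ψ)) * U' (ω + ψ) (EuclideanSpace.single y (1 : ℝ))
        ∂(multivariateGaussian 0 (A * Aᵀ)))))) ∂(multivariateGaussian 0 (A * Aᵀ)))) * ((∫ ω : EuclideanSpace ℝ ι, exp (-U (ω + ψ))
        ∂(multivariateGaussian 0 (A * Aᵀ)))⁻¹ * (∫ ω : EuclideanSpace ℝ ι, exp (-U (ω + ψ)) * ((U' (ω + ψ) (EuclideanSpace.single z (1 : ℝ)) - ((∫ ω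
        : EuclideanSpace ℝ ι, exp (-U (ω + ψ)) ∂(multivariateGaussian 0 (A * Aᵀ)))⁻¹ * (∫ ω : EuclideanSpace ℝ ι, exp (-U (ω + ψ)) * U' (ω + ψ)
        (EuclideanSpace.single z (1 : ℝ)) ∂(multivariateGaussian 0 (A * Aᵀ))))) * (U' (ω + ψ) (EuclideanSpace.single t (1 : ℝ)) - ((∫ ω :
        EuclideanSpace ℝ ι, exp (-U (ω + ψ)) ∂(multivariateGaussian 0 (A * Aᵀ)))⁻¹ * (∫ ω : EuclideanSpace ℝ ι, exp (-U (ω + ψ)) * U' (ω + ψ)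
        (EuclideanSpace.single t (1 : ℝ)) ∂(multivariateGaussian 0 (A * Aᵀ)))))) ∂(multivariateGaussian 0 (A * Aᵀ)))) - ((∫ ω : EuclideanSpace ℝ ι,
        exp (-U (ω + ψ)) ∂(multivariateGaussian 0 (A * Aᵀ)))⁻¹ * (∫ ω : EuclideanSpace ℝ ι, exp (-U (ω + ψ)) * ((U' (ω + ψ) (EuclideanSpace.single x
        (1 : ℝ)) - ((∫ ω : EuclideanSpace ℝ ι, exp (-U (ω + ψ)) ∂(multivariateGaussian 0 (A * Aᵀ)))⁻¹ * (∫ ω : EuclideanSpace ℝ ι, exp (-U (ω + ψ)) *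
        U' (ω + ψ) (EuclideanSpace.single x (1 : ℝ)) ∂(multivariateGaussian 0 (A * Aᵀ))))) * (U' (ω + ψ) (EuclideanSpace.single z (1 : ℝ)) - ((∫ ω :
        EuclideanSpace ℝ ι, exp (-U (ω + ψ)) ∂(multivariateGaussian 0 (A * Aᵀ)))⁻¹ * (∫ ω : EuclideanSpace ℝ ι, exp (-U (ω + ψ)) * U' (ω + ψ)
        (EuclideanSpace.single z (1 : ℝ)) ∂(multivariateGaussian 0 (A * Aᵀ)))))) ∂(multivariateGaussian 0 (A * Aᵀ)))) * ((∫ ω : EuclideanSpace ℝ ι,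
        exp (-U (ω + ψ)) ∂(multivariateGaussian 0 (A * Aᵀ)))⁻¹ * (∫ ω : EuclideanSpace ℝ ι, exp (-U (ω + ψ)) * ((U' (ω + ψ) (EuclideanSpace.single y
        (1 : ℝ)) - ((∫ ω : EuclideanSpace ℝ ι, exp (-U (ω + ψ)) ∂(multivariateGaussian 0 (A * Aᵀ)))⁻¹ * (∫ ω : EuclideanSpace ℝ ι, exp (-U (ω + ψ)) *
        U' (ω + ψ) (EuclideanSpace.single y (1 : ℝ)) ∂(multivariateGaussian 0 (A * Aᵀ))))) * (U' (ω + ψ) (EuclideanSpace.single t (1 : ℝ)) - ((∫ ω :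
        EuclideanSpace ℝ ι, exp (-U (ω + ψ)) ∂(multivariateGaussian 0 (A * Aᵀ)))⁻¹ * (∫ ω : EuclideanSpace ℝ ι, exp (-U (ω + ψ)) * U' (ω + ψ)
        (EuclideanSpace.single t (1 : ℝ)) ∂(multivariateGaussian 0 (A * Aᵀ)))))) ∂(multivariateGaussian 0 (A * Aᵀ)))) - ((∫ ω : EuclideanSpace ℝ ι,
        exp (-U (ω + ψ)) ∂(multivariateGaussian 0 (A * Aᵀ)))⁻¹ * (∫ ω : EuclideanSpace ℝ ι, exp (-U (ω + ψ)) * ((U' (ω + ψ) (EuclideanSpace.single x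
        (1 : ℝ)) - ((∫ ω : EuclideanSpace ℝ ι, exp (-U (ω + ψ)) ∂(multivariateGaussian 0 (A * Aᵀ)))⁻¹ * (∫ ω : EuclideanSpace ℝ ι, exp (-U (ω + ψ)) *
        U' (ω + ψ) (EuclideanSpace.single x (1 : ℝ)) ∂(multivariateGaussian 0 (A * Aᵀ))))) * (U' (ω + ψ) (EuclideanSpace.single t (1 : ℝ)) - ((∫ ω :
        EuclideanSpace ℝ ι, exp (-U (ω + ψ)) ∂(multivariateGaussian 0 (A * Aᵀ)))⁻¹ * (∫ ω : EuclideanSpace ℝ ι, exp (-U (ω + ψ)) * U' (ω + ψ)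
        (EuclideanSpace.single t (1 : ℝ)) ∂(multivariateGaussian 0 (A * Aᵀ)))))) ∂(multivariateGaussian 0 (A * Aᵀ)))) * ((∫ ω : EuclideanSpace ℝ ι,
        exp (-U (ω + ψ)) ∂(multivariateGaussian 0 (A * Aᵀ)))⁻¹ * (∫ ω : EuclideanSpace ℝ ι, exp (-U (ω + ψ)) * ((U' (ω + ψ) (EuclideanSpace.single y
        (1 : ℝ)) - ((∫ ω : EuclideanSpace ℝ ι, exp (-U (ω + ψ)) ∂(multivariateGaussian 0 (A * Aᵀ)))⁻¹ * (∫ ω : EuclideanSpace ℝ ι, exp (-U (ω + ψ)) *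
        U' (ω + ψ) (EuclideanSpace.single y (1 : ℝ)) ∂(multivariateGaussian 0 (A * Aᵀ))))) * (U' (ω + ψ) (EuclideanSpace.single z (1 : ℝ)) - ((∫ ω :
        EuclideanSpace ℝ ι, exp (-U (ω + ψ)) ∂(multivariateGaussian 0 (A * Aᵀ)))⁻¹ * (∫ ω : EuclideanSpace ℝ ι, exp (-U (ω + ψ)) * U' (ω + ψ)
        (EuclideanSpace.single z (1 : ℝ)) ∂(multivariateGaussian 0 (A * Aᵀ)))))) ∂(multivariateGaussian 0 (A * Aᵀ))))| ≤
      (4 * (αθ * dθ * (βθ * dθ') / (1 - lamA)) + 3 * (αθ * dθ * (βθ * dθ') / (1 - lamA)) ^ 2 + 4 * (5 * (κ₂ ^ 4 * γop ^ 2) / (1 - lam * γop) ^ 2) + 4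
          * (50 * (κ₂ ^ 6 * γop ^ 3) / (1 - lam * γop) ^ 3) + 2 * (((5 * (κ₂ ^ 4 * γop ^ 2) / (1 - lam * γop) ^ 2) + 1) / 2) * ((((5 * (κ₂ ^ 4 * γop
              ^ 2) / (1 - lam * γop) ^ 2) + 1) / 2) + (5 *
          (κ₂ ^ 4 * γop ^ 2) / (1 - lam * γop) ^ 2))) * (16 * S' ^ 3) := by
  haveI : Nonempty ι := ⟨x⟩
  have hUc : Continuous U := continuous_iff_continuousAt.2 fun φ => (hUd φ).continuousAt
  have hU'c : Continuous U' := continuous_iff_continuousAt.2 fun φ => (hU'd φ).continuousAt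
  have h := whitened_fourth_cumulant_row_letter hΓop Y hUd hU'd hU''c hκ₀ hκ₁ ha hτ hδ hθ0 hθ1 hκθ hκθw hstab hU'b hU''b hlam hUsec hρg hHk hHk0 ψ
      hαr hαc hhr hlamA hlamA1 hγ hγ1 hD hDC hθnn hDθr hdθ hDθc hdθ' hσ0 hσθ hr1 hrσ haσ hβ haσ'
    (fun v c => whitened_sixth_power_integrable hΓop Y hUd hU'd hκ₀ hκ₁ ha hτ hδ hθ0 hθ1 hκθ hstab hU'b ψ v c)
    (fun v => whitened_sixth_moment_gibbs hΓop Y hUd hU'd hU''c hκ₀ hκ₁ ha hτ hδ hθ0 hθ1 hκθ hstab hU'b hU''b hlam hUsec hρg ψ v) hSr hSc x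
  refine le_trans (le_of_eq (Finset.sum_congr rfl fun y _ => Finset.sum_congr rfl fun z _ => Finset.sum_congr rfl fun t _ => ?_)) h
  rw [whitened_mean_bridge hUc hU'c A ψ (EuclideanSpace.single x (1 : ℝ)), whitened_mean_bridge hUc hU'c A ψ (EuclideanSpace.single y (1 : ℝ)),
    whitened_mean_bridge hUc hU'c A ψ (EuclideanSpace.single z (1 : ℝ)), whitened_mean_bridge hUc hU'c A ψ (EuclideanSpace.single t (1 : ℝ)),
    whitened_quad_bridge hUc hU'c A ψ, whitened_pair_bridge hUc hU'c A ψ, whitened_pair_bridge hUc hU'c A ψ, whitened_pair_bridge hUc hU'c A ψ,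
    whitened_pair_bridge hUc hU'c A ψ, whitened_pair_bridge hUc hU'c A ψ, whitened_pair_bridge hUc hU'c A ψ]

end Kappa4

/-! ## §4. The fifteen-term split -/

omit [Fintype ι] [DecidableEq ι] [Fintype κ] [DecidableEq κ] in
/-- `|a − (b₁+b₂+b₃+b₄) − (c₁+c₂+c₃) + (d₁+⋯+d₆) − e| ≤ |a| + Σ|bᵢ| + Σ|cᵢ| + Σ|dᵢ| + |e|`. [folklore] -/
theorem abs_fifteen_split (a b₁ b₂ b₃ b₄ c₁ c₂ c₃ d₁ d₂ d₃ d₄ d₅ d₆ e : ℝ) :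
    |a - (b₁ + b₂ + b₃ + b₄) - (c₁ + c₂ + c₃) + (d₁ + d₂ + d₃ + d₄ + d₅ + d₆) - e| ≤
      |a| + |b₁| + |b₂| + |b₃| + |b₄| + |c₁| + |c₂| + |c₃| + |d₁| + |d₂| + |d₃| + |d₄| + |d₅| + |d₆| + |e| := by
  have h1 := abs_sub (a - (b₁ + b₂ + b₃ + b₄) - (c₁ + c₂ + c₃) + (d₁ + d₂ + d₃ + d₄ + d₅ + d₆)) e
  have h2 := abs_add_le (a - (b₁ + b₂ + b₃ + b₄) - (c₁ + c₂ + c₃)) (d₁ + d₂ + d₃ + d₄ + d₅ + d₆)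
  have h3 := abs_sub (a - (b₁ + b₂ + b₃ + b₄)) (c₁ + c₂ + c₃)
  have h4 := abs_sub a (b₁ + b₂ + b₃ + b₄)
  have hb := abs_add_le (b₁ + b₂ + b₃) b₄; have hb' := abs_add_le (b₁ + b₂) b₃; have hb'' := abs_add_le b₁ b₂
  have hc := abs_add_le (c₁ + c₂) c₃; have hc' := abs_add_le c₁ c₂
  have hd := abs_add_le (d₁ + d₂ + d₃ + d₄ + d₅) d₆; have hd' := abs_add_le (d₁ + d₂ + d₃ + d₄) d₅
  have hd'' := abs_add_le (d₁ + d₂ + d₃) d₄; have hd3 := abs_add_le (d₁ + d₂) d₃; have hd4 := abs_add_le d₁ d₂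
  linarith

/-! ## §5. Toy -/

/-- Toy (§1 on `Fin 2`): the cyclic reindexing of a triple sum. -/
example (f : Fin 2 → Fin 2 → Fin 2 → ℝ) : ∑ y, ∑ z, ∑ t, f z t y = ∑ y, ∑ z, ∑ t, f y z t := sum3_cycle f

end Summit.QuantumFields.BalabanUV.T4Continuum.NE7b.SupWhitenedFourthKernelPieces

end
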